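import Summits.BirchSwinnertonDyer.BirchSwinnertonDyer.Theorems.GenusKolyvaginAtTwoGenusDeepSupplyAtTwoNegDiscNarrowKFourCellHalvingDescentKFourNeg
import Summits.BirchSwinnertonDyer.BirchSwinnertonDyer.Theorems.GenusKolyvaginAtTwoShaCardDvdPowAtTwoRTShaRatExactOnCut
import Summits.BirchSwinnertonDyer.BirchSwinnertonDyer.Theorems.GenusKolyvaginAtTwoShaCardDvdPowAtTwoRTShaFiniteAtTwoCTQ
import Summits.BirchSwinnertonDyer.BirchSwinnertonDyer.Theorems.GenusKolyvaginAtTwoShaCardDvdPowAtTwoRTSharpExponentRatPoints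
import HarnessLib

/-!
# Route `GenusKolyvaginAtTwo`, crux K₄ `K4Neg` (stmt-BirchSwinnertonDyer-31526) — THE `Ш(E/ℚ)`-CARDINALITY CURRENCY OF K₄ ON THE CUT:
# modulo Q2, K4Neg at `E` ⟺ `#Ш(E/ℚ)[2^∞] = 4^(M₀)` ⟺ `4^(M₀) ∣ #Ш(E/ℚ)[2^∞]` (no leaf, no Gross–Zagier, no GZK)

LEAD seat `bsd-line-gk2-p1` g24 (cell `bsd-f1-sign2`), `--supports stmt-BirchSwinnertonDyer-31526 --as helper`.  THEOREMS ONLY (no definition,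
no named fact, no `sorry`).  **BSD is NOT proved by this file; K4Neg is NOT proved; nothing is closed.**

WHAT.  On K4Neg's frame VERBATIM (habitat: `E/ℚ` globally minimal, non-CM, `r_an(E) = 0`, `ρ_{E,2^n}` onto, `C(E)` odd, `Δ_E < 0`, `#Sel₂(E) = 4`;
prime Heegner frame `K = ℚ(√−ℓ₀)`, `d_K` odd `≠ −3`, Heegner, the two B₂ non-squares, `2` split; an odd-Manin datum `Dt`; `y_K = P(1)` of
infinite order with `2^(M₀) ∥` its divisibility, `1 ≤ M₀`; a globally minimal twin `Wd ≅ E^(d_K)` of analytic rank `1`, `#Sel₂(Wd) = 2`,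
`ord₂ C(Wd) ≤ 1`) PLUS one odd multiplicative prime `v` of `E` (the cut) and Q2 `KolyvaginRelationAtTwo` by name (= print 23091):
* §1 `natCard_sha_rat_two_eq_pow_of_kFourNeg_witness` — K4Neg's CONCLUSION (a square-free `n` of `FrobEqFrobInfty` Kolyvagin primes of index
  `≥ 2` with `P(n) ∉ 2E(K[n])`) ⟹ **`#Ш(E/ℚ)[2^∞] = 2^(2·M₀)`** (gk2-p4 g23's `…ShaRatExactOnCut` §2 = PAIRCOUNT + SANDWICH′ + L_T + Cassels–Tate
  squareness over `ℚ`, read on K4Neg's frame; `w(E) = +1` from `r_an(E) = 0`).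
* §2 `kFourNeg_conclusion_of_pow_dvd_natCard_sha_rat` — **`2^(2·M₀) ∣ #Ш(E/ℚ)[2^∞]` ⟹ K4Neg's CONCLUSION**: if there is no witness, gk2-p5 g36's
  B2Q♭ shape theorem (`kFourNeg_shape_of_two_pow_pred_smul_ne_zero`, p771204) makes `2^(M₀−1)` kill every Selmer class over `ℚ`, hence (Kummer
  surjection `Sel_(2^k)(E/ℚ) ↠ Ш(E/ℚ)[2^k]`) all of `Ш(E/ℚ)[2^∞]`; with `#Ш(E/ℚ)[2] ≤ 4` (RANKQ, the twin's Tamagawa budget) the tree's (CTQ) bound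
  `#A ≤ (#A[2])^e` gives `#Ш(E/ℚ)[2^∞] ∣ 4^(M₀−1)` — incompatible with `4^(M₀) ∣ #Ш(E/ℚ)[2^∞]`.  NO rank hypothesis, NO leaf, NO print
  beyond Q2 (finiteness and squareness of `Ш(E/ℚ)[2^∞]` on the frame are tree theorems modulo Q2: `…RTShaFiniteAtTwoRat`).
* §3 `kFourNeg_conclusion_iff_natCard_sha_rat_eq_pow`, `kFourNeg_conclusion_iff_pow_dvd_natCard_sha_rat` — the EQUIVALENCES.
* §4 the same in `Ш(E_K/K)`-currency: `natCard_sha_baseChange_two_eq_pow_of_kFourNeg_witness` (Kolyvagin EXACTNESS Q3R_T′ read on the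
  frame), `kFourNeg_conclusion_of_pow_dvd_natCard_sha_baseChange` (B2Q♭ + `rank E(ℚ) = 0` mod Q2 + g34's decoupled sandwich), and the `↔`s
  `kFourNeg_conclusion_iff_natCard_sha_baseChange`: K₄ is exactly the SHARPNESS of Kolyvagin's bound `#Ш(E/K)[2^∞] ∣ 4^(M₀)` (U_T′).
READING (LEAD-BRIEF-g23-ADDENDUM B.3, now a kernel statement): on the cut, modulo Q2, the beyond-print kernel K4Neg at `E` IS «`#Ш(E/ℚ)[2^∞] =
4^(M₀)`» — the `2`-part of BSD for the rank-`0` member given the Gross–Zagier index (`Ш_an(E) = 4^(M₀)` on these cells by GZ + BSD₂ of the twin);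
Kolyvagin's B₂ gives `∣ 4^(M₀)` (PAIRCOUNT), the reverse divisibility is the open mathematics.  This is the Kolyvagin-free restatement currency
offered to the route pen for 31526 (and, mutatis mutandis, 31469).  BSD is NOT proved by any of this.

References: [McCallumLMS1991] §5 Lemma 5.3, Thm. 5.4, Cor. 5.6; [Kolyvagin1989Izv] Thm. B₂; [Kolyvagin1991MathAnn] Thm. 1; [Kramer1981] Thm. 1;
[Cassels1962ArithmeticIV] Thm. 1.1; [GrossLMS1991] §10; [Fuchs1970] §8 Thm. 8.4.
-/

set_option autoImplicit false
-- the Theorems namespace of this sub repeats the summit name by design (D-0017 nested layout)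
set_option linter.dupNamespace false

noncomputable section

open scoped Classical
open scoped AddSubgroup

namespace Summit.BirchSwinnertonDyer.BirchSwinnertonDyer.Theorems.GenusSupplyNarrow.KFourCell.ShaCardCurrency

open WeierstrassCurve NumberField IsDedekindDomain Field Literature.NumberTheory.EllipticCurves
  Literature.NumberTheory.GaloisRepresentations Literature.NumberTheory.EllipticCurves.ModularForms AddSubgroup
open Summit.BirchSwinnertonDyer.BirchSwinnertonDyer.Theses.GenusKolyvaginAtTwo (KolyvaginRelationAtTwo)
open Summit.BirchSwinnertonDyer.BirchSwinnertonDyer.Theorems.GenusExact.RationalPairDescent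
open Summit.BirchSwinnertonDyer.BirchSwinnertonDyer.Theorems.GenusExact.PlusDescent

/-! ## §1 A deep witness gives `#Ш(E/ℚ)[2^∞] = 4^(M₀)` on K4Neg's frame (cut, mod Q2) -/

/-- **K4Neg's conclusion ⟹ `#Ш(E/ℚ)[2^∞] = 2^(2·M₀)`** on K4Neg's frame (binders VERBATIM, incl. the idle prime-frame / Selmer-cell / odd-Manin
ones) + one odd multiplicative prime `v` + Q2.  The witness is consumed in K4Neg's own deep currency (`IsKolyvaginPrime ∧ 2 ≤ kolyvaginIndex ∧
FrobEqFrobInfty`); `w(E) = +1` comes from `r_an(E) = 0` by the functional equation of `Dt`'s newform.  BSD is NOT proved by this.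
[cite: McCallumLMS1991, §5 Thm. 5.4, Cor. 5.6] [cite: Kolyvagin1991MathAnn, Thm. 1] [cite: Kramer1981, Thm. 1] [cite: Cassels1962ArithmeticIV, Thm. 1.1] -/
theorem natCard_sha_rat_two_eq_pow_of_kFourNeg_witness (hQ2 : KolyvaginRelationAtTwo)
    (W : WeierstrassCurve ℚ) [W.IsElliptic] [W.IsGloballyMinimal] [NeZero (W.conductorNorm ℤ)] (hcm : ¬ W.HasCM)
    (hr0 : W.analyticRank = 0) (hρ : ∀ n : ℕ, 0 < n → W.HasSurjectiveModNGaloisRep ((2 : ℤ) ^ n)) (hT : Odd W.tamagawaProduct)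
    (hneg : W.Δ < 0) (_h4 : Nat.card (W.selmerGroup 2) = 4)
    (K : Type) [Field K] [NumberField K] (hIQ : IsImaginaryQuadratic K) (hodd : Odd (NumberField.discr K))
    (h3 : NumberField.discr K ≠ -3) (hHe : SatisfiesHeegnerHypothesis (W.conductorNorm ℤ) K)
    (hsq1 : ¬ IsSquare ((NumberField.discr K : ℚ) * -|W.Δ|)) (hsq2 : ¬ IsSquare ((NumberField.discr K : ℚ) * (-(2 * |W.Δ|))))
    (_ℓ₀ : ℕ) (_hℓ₀ : _ℓ₀.Prime) (_hdK : NumberField.discr K = -(_ℓ₀ : ℤ))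
    (_h2K : ((Ideal.span {(2 : ℤ)}).primesOver (𝓞 K)).ncard = 2)
    (Dt : ModularParametrizationData W (W.conductorNorm ℤ))
    (_hopt : ∀ z ∈ Dt.L.lattice, ∃ w ∈ periodLattice Dt.f, z = (Dt.c : ℂ) * w) (_hc : Odd Dt.c)
    (β : ℤ) (ι : K →+* ℂ) (d₁ : KolyvaginHeegnerData Dt β ι 1) (hy : ¬ IsOfFinAddOrder d₁.derivedPoint) (M₀ : ℕ)
    (hdiv : ∃ Q : (W.baseChange (ringClassField K ι 1)).toAffine.Point, ((2 ^ M₀ : ℕ) : ℤ) • Q = d₁.derivedPoint)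
    (hndiv : ¬ ∃ Q : (W.baseChange (ringClassField K ι 1)).toAffine.Point, ((2 ^ (M₀ + 1) : ℕ) : ℤ) • Q = d₁.derivedPoint)
    (_hM₀ : 1 ≤ M₀) (Wd : WeierstrassCurve ℚ) [Wd.IsElliptic] [Wd.IsGloballyMinimal]
    (hWd : ∃ C : VariableChange ℚ, C • W.quadraticTwist (NumberField.discr K : ℚ) = Wd) (_hrd : Wd.analyticRank = 1)
    (hSel : Nat.card (Wd.selmerGroup 2) = 2) (hDEF : padicValNat 2 Wd.tamagawaProduct ≤ 1)
    -- the cut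
    (v : HeightOneSpectrum (𝓞 ℚ)) (h2v : ((2 : ℕ) : 𝓞 ℚ) ∉ v.asIdeal) (hNv : ((W.conductorNorm ℤ : ℕ) : 𝓞 ℚ) ∈ v.asIdeal)
    (hmult : W.HasMultiplicativeReductionAt v)
    -- K4Neg's conclusion
    (hK4 : ∃ (n : ℕ) (d : KolyvaginHeegnerData Dt β ι n), Squarefree n ∧
      (∀ ℓ ∈ n.primeFactors, Zhang2014.IsKolyvaginPrime (W.conductorNorm ℤ) W K 2 ℓ ∧ 2 ≤ Zhang2014.kolyvaginIndex W 2 ℓ ∧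
        FrobEqFrobInfty W K 2 ℓ) ∧
      ¬ ∃ Q : (W.baseChange (ringClassField K ι n)).toAffine.Point, (2 : ℤ) • Q = d.derivedPoint) :
    Nat.card (AddCommGroup.primaryComponent W.sha 2) = 2 ^ (2 * M₀) := by
  -- `w(E) = +1` from `r_an(E) = 0`
  have hw : W.rootNumber = 1 :=
    (Literature.Barriers.BirchSwinnertonDyer.even_analyticRank_iff_of_isNewformOf_conductorLevel Dt.isNewformOf).mp
      (by rw [hr0]; exact Even.zero)
  obtain ⟨n, d, hn, hKoly, hPn⟩ := hK4
  exact natCard_primaryComponent_sha_rat_two_eq_pow_onCut_of_kolyvaginRelation hQ2 W hcm hT v h2v hNv hmult hneg K hIQ hodd h3 hHe hsq1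
    hsq2 hρ Dt β ι d₁ hy M₀ hdiv hndiv hw Wd hWd hSel hDEF n d hn hKoly hPn

/-! ## §2 `4^(M₀) ∣ #Ш(E/ℚ)[2^∞]` gives a deep witness (cut, mod Q2) -/

/-- **`2^(2·M₀) ∣ #Ш(E/ℚ)[2^∞]` ⟹ K4Neg's conclusion** on K4Neg's frame (binders VERBATIM) + one odd multiplicative prime `v` + Q2.  If no
square-free `n` of `FrobEqFrobInfty` Kolyvagin primes of index `≥ 2` has `P(n) ∉ 2E(K[n])`, B2Q♭ (gk2-p5 g36, `kFourNeg_shape_of_two_pow_pred_smul_ne_zero`)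
forces `2^(M₀−1) · Sel_(2^k)(E/ℚ) = 0` for every `k`, hence `2^(M₀−1) · Ш(E/ℚ)[2^∞] = 0` (Kummer: `Sel_(2^k) ↠ Ш[2^k]`, tree
`map_torsionH1ToH1_selmerGroup_holds`); with `#Ш(E/ℚ)[2] ≤ 4` (RANKQ from the twin's budget) the (CTQ) bound gives `#Ш(E/ℚ)[2^∞] ∣ 4^(M₀−1)`,
contradicting `4^(M₀) ∣ #Ш(E/ℚ)[2^∞]` (`M₀ ≥ 1`).  NO rank / leaf / Gross–Zagier hypothesis.  BSD is NOT proved by this; K4Neg is NOT proved by this.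
[cite: McCallumLMS1991, §5 Lemma 5.3, Thm. 5.4, Cor. 5.6] [cite: Kolyvagin1989Izv, Thm. B₂] [cite: Fuchs1970, §8 Thm. 8.4] -/
theorem kFourNeg_conclusion_of_pow_dvd_natCard_sha_rat (hQ2 : KolyvaginRelationAtTwo)
    (W : WeierstrassCurve ℚ) [W.IsElliptic] [W.IsGloballyMinimal] [NeZero (W.conductorNorm ℤ)] (hcm : ¬ W.HasCM)
    (hr0 : W.analyticRank = 0) (hρ : ∀ n : ℕ, 0 < n → W.HasSurjectiveModNGaloisRep ((2 : ℤ) ^ n)) (hT : Odd W.tamagawaProduct)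
    (hneg : W.Δ < 0) (_h4 : Nat.card (W.selmerGroup 2) = 4)
    (K : Type) [Field K] [NumberField K] (hIQ : IsImaginaryQuadratic K) (hodd : Odd (NumberField.discr K))
    (h3 : NumberField.discr K ≠ -3) (hHe : SatisfiesHeegnerHypothesis (W.conductorNorm ℤ) K)
    (hsq1 : ¬ IsSquare ((NumberField.discr K : ℚ) * -|W.Δ|)) (hsq2 : ¬ IsSquare ((NumberField.discr K : ℚ) * (-(2 * |W.Δ|))))
    (_ℓ₀ : ℕ) (_hℓ₀ : _ℓ₀.Prime) (_hdK : NumberField.discr K = -(_ℓ₀ : ℤ))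
    (_h2K : ((Ideal.span {(2 : ℤ)}).primesOver (𝓞 K)).ncard = 2)
    (Dt : ModularParametrizationData W (W.conductorNorm ℤ))
    (_hopt : ∀ z ∈ Dt.L.lattice, ∃ w ∈ periodLattice Dt.f, z = (Dt.c : ℂ) * w) (_hc : Odd Dt.c)
    (β : ℤ) (ι : K →+* ℂ) (d₁ : KolyvaginHeegnerData Dt β ι 1) (_hy : ¬ IsOfFinAddOrder d₁.derivedPoint) (M₀ : ℕ)
    (_hdiv : ∃ Q : (W.baseChange (ringClassField K ι 1)).toAffine.Point, ((2 ^ M₀ : ℕ) : ℤ) • Q = d₁.derivedPoint)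
    (hndiv : ¬ ∃ Q : (W.baseChange (ringClassField K ι 1)).toAffine.Point, ((2 ^ (M₀ + 1) : ℕ) : ℤ) • Q = d₁.derivedPoint)
    (hM₀ : 1 ≤ M₀) (Wd : WeierstrassCurve ℚ) [Wd.IsElliptic] [Wd.IsGloballyMinimal]
    (hWd : ∃ C : VariableChange ℚ, C • W.quadraticTwist (NumberField.discr K : ℚ) = Wd) (_hrd : Wd.analyticRank = 1)
    (hSel : Nat.card (Wd.selmerGroup 2) = 2) (hDEF : padicValNat 2 Wd.tamagawaProduct ≤ 1)
    -- the cut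
    (v : HeightOneSpectrum (𝓞 ℚ)) (h2v : ((2 : ℕ) : 𝓞 ℚ) ∉ v.asIdeal) (hNv : ((W.conductorNorm ℤ : ℕ) : 𝓞 ℚ) ∈ v.asIdeal)
    (hmult : W.HasMultiplicativeReductionAt v)
    -- the `Ш(E/ℚ)`-cardinality hypothesis
    (hSha : 2 ^ (2 * M₀) ∣ Nat.card (AddCommGroup.primaryComponent W.sha 2)) :
    ∃ (n : ℕ) (d : KolyvaginHeegnerData Dt β ι n), Squarefree n ∧
      (∀ ℓ ∈ n.primeFactors, Zhang2014.IsKolyvaginPrime (W.conductorNorm ℤ) W K 2 ℓ ∧ 2 ≤ Zhang2014.kolyvaginIndex W 2 ℓ ∧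
        FrobEqFrobInfty W K 2 ℓ) ∧
      ¬ ∃ Q : (W.baseChange (ringClassField K ι n)).toAffine.Point, (2 : ℤ) • Q = d.derivedPoint := by
  haveI : Fact (Nat.Prime 2) := ⟨Nat.prime_two⟩
  -- `w(E) = +1` from `r_an(E) = 0`
  have hw : W.rootNumber = 1 :=
    (Literature.Barriers.BirchSwinnertonDyer.even_analyticRank_iff_of_isNewformOf_conductorLevel Dt.isNewformOf).mp
      (by rw [hr0]; exact Even.zero)
  by_contra hno
  -- no witness ⟹ `2^(M₀-1)` kills every `2`-power-torsion class of `Ш(E/ℚ)` (B2Q♭ shape + Kummer surjection)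
  have hB2Q : ∀ (k : ℕ) (a : W.galH1), a ∈ W.sha → ((2 ^ k : ℕ) : ℤ) • a = 0 → ((2 ^ (M₀ - 1) : ℕ) : ℤ) • a = 0 := by
    intro k a ha hka
    by_contra hne
    rcases Nat.eq_zero_or_pos k with rfl | hkpos
    · rw [pow_zero, Nat.cast_one, one_zsmul] at hka
      exact hne (by rw [hka, zsmul_zero])
    · have hn : ((2 ^ k : ℕ) : ℤ) ≠ 0 := by positivity
      have hmem : a ∈ W.sha ⊓ torsionBy W.galH1 ((2 ^ k : ℕ) : ℤ) :=
        AddSubgroup.mem_inf.mpr ⟨ha, by change ((2 ^ k : ℕ) : ℤ) • a = 0; exact hka⟩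
      rw [← WeierstrassCurve.map_torsionH1ToH1_selmerGroup_holds W hn] at hmem
      obtain ⟨x, hx, rfl⟩ := AddSubgroup.mem_map.mp hmem
      have hne' : ((2 ^ (M₀ - 1) : ℕ) : ℤ) • x ≠ 0 := fun h ↦ hne (by rw [← map_zsmul, h, map_zero])
      exact hno (kFourNeg_shape_of_two_pow_pred_smul_ne_zero hQ2 W hcm hneg hT v h2v hNv hmult K hIQ hodd h3 hHe hsq1 hsq2 hρ Dt β ι d₁ M₀
        hndiv hw ⟨k, x, hx, hne'⟩)
  have hexp : ∀ x ∈ AddCommGroup.primaryComponent W.sha 2, 2 ^ (M₀ - 1) • x = 0 :=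
    forall_primaryComponent_sha_two_pow_smul_eq_zero_of_galH1 W hB2Q
  -- `#Ш(E/ℚ)[2] ≤ 4` (RANKQ from the twin's Tamagawa budget)
  have h4 : Nat.card (AddSubgroup.torsionBy W.sha ((2 : ℕ) : ℤ)) ≤ 4 := by
    have h := natCard_sha_torsionBy_two_dvd_four_of_genusBudget_le_one_unramified W hneg hT hIQ hodd hHe Wd hWd hDEF hSel
    exact Nat.le_of_dvd (by norm_num) (by simpa using h)
  -- (CTQ): `#Ш(E/ℚ)[2^∞] ∣ 4^(M₀-1)`
  have hdvd := natCard_primaryComponent_sha_rat_two_dvd_of_exponent_of_card_sha_two_torsion_le_onHabitat hQ2 W hcm hT v h2v hNv hmult hneg K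
    hIQ hodd h3 hHe hsq1 hsq2 hρ Dt β ι d₁ M₀ hndiv hexp h4
  have hle : 2 * M₀ ≤ 2 * (M₀ - 1) := (Nat.pow_dvd_pow_iff_le_right (by norm_num : 1 < 2)).mp (hSha.trans hdvd)
  omega

/-! ## §3 The equivalences -/

/-- **K4Neg at `E` ⟺ `#Ш(E/ℚ)[2^∞] = 2^(2·M₀)`**, on K4Neg's frame (binders VERBATIM) + one odd multiplicative prime + Q2 (§1 and §2).  The
`Ш(E/ℚ)`-cardinality (Kolyvagin-free) currency of the beyond-print kernel K₄: the `2`-part of BSD for the rank-`0` member of the Heegner pair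
given the Gross–Zagier index.  BSD is NOT proved by this; K4Neg is NOT proved by this.
[cite: McCallumLMS1991, §5 Thm. 5.4, Cor. 5.6] [cite: Kolyvagin1989Izv, Thm. B₂] [cite: Kolyvagin1991MathAnn, Thm. 1] [cite: Kramer1981, Thm. 1] -/
theorem kFourNeg_conclusion_iff_natCard_sha_rat_eq_pow (hQ2 : KolyvaginRelationAtTwo)
    (W : WeierstrassCurve ℚ) [W.IsElliptic] [W.IsGloballyMinimal] [NeZero (W.conductorNorm ℤ)] (hcm : ¬ W.HasCM)
    (hr0 : W.analyticRank = 0) (hρ : ∀ n : ℕ, 0 < n → W.HasSurjectiveModNGaloisRep ((2 : ℤ) ^ n)) (hT : Odd W.tamagawaProduct)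
    (hneg : W.Δ < 0) (h4 : Nat.card (W.selmerGroup 2) = 4)
    (K : Type) [Field K] [NumberField K] (hIQ : IsImaginaryQuadratic K) (hodd : Odd (NumberField.discr K))
    (h3 : NumberField.discr K ≠ -3) (hHe : SatisfiesHeegnerHypothesis (W.conductorNorm ℤ) K)
    (hsq1 : ¬ IsSquare ((NumberField.discr K : ℚ) * -|W.Δ|)) (hsq2 : ¬ IsSquare ((NumberField.discr K : ℚ) * (-(2 * |W.Δ|))))
    (ℓ₀ : ℕ) (hℓ₀ : ℓ₀.Prime) (hdK : NumberField.discr K = -(ℓ₀ : ℤ))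
    (h2K : ((Ideal.span {(2 : ℤ)}).primesOver (𝓞 K)).ncard = 2)
    (Dt : ModularParametrizationData W (W.conductorNorm ℤ))
    (hopt : ∀ z ∈ Dt.L.lattice, ∃ w ∈ periodLattice Dt.f, z = (Dt.c : ℂ) * w) (hc : Odd Dt.c)
    (β : ℤ) (ι : K →+* ℂ) (d₁ : KolyvaginHeegnerData Dt β ι 1) (hy : ¬ IsOfFinAddOrder d₁.derivedPoint) (M₀ : ℕ)
    (hdiv : ∃ Q : (W.baseChange (ringClassField K ι 1)).toAffine.Point, ((2 ^ M₀ : ℕ) : ℤ) • Q = d₁.derivedPoint)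
    (hndiv : ¬ ∃ Q : (W.baseChange (ringClassField K ι 1)).toAffine.Point, ((2 ^ (M₀ + 1) : ℕ) : ℤ) • Q = d₁.derivedPoint)
    (hM₀ : 1 ≤ M₀) (Wd : WeierstrassCurve ℚ) [Wd.IsElliptic] [Wd.IsGloballyMinimal]
    (hWd : ∃ C : VariableChange ℚ, C • W.quadraticTwist (NumberField.discr K : ℚ) = Wd) (hrd : Wd.analyticRank = 1)
    (hSel : Nat.card (Wd.selmerGroup 2) = 2) (hDEF : padicValNat 2 Wd.tamagawaProduct ≤ 1)
    (v : HeightOneSpectrum (𝓞 ℚ)) (h2v : ((2 : ℕ) : 𝓞 ℚ) ∉ v.asIdeal) (hNv : ((W.conductorNorm ℤ : ℕ) : 𝓞 ℚ) ∈ v.asIdeal)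
    (hmult : W.HasMultiplicativeReductionAt v) :
    (∃ (n : ℕ) (d : KolyvaginHeegnerData Dt β ι n), Squarefree n ∧
      (∀ ℓ ∈ n.primeFactors, Zhang2014.IsKolyvaginPrime (W.conductorNorm ℤ) W K 2 ℓ ∧ 2 ≤ Zhang2014.kolyvaginIndex W 2 ℓ ∧
        FrobEqFrobInfty W K 2 ℓ) ∧
      ¬ ∃ Q : (W.baseChange (ringClassField K ι n)).toAffine.Point, (2 : ℤ) • Q = d.derivedPoint) ↔
    Nat.card (AddCommGroup.primaryComponent W.sha 2) = 2 ^ (2 * M₀) :=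
  ⟨fun hK4 ↦ natCard_sha_rat_two_eq_pow_of_kFourNeg_witness hQ2 W hcm hr0 hρ hT hneg h4 K hIQ hodd h3 hHe hsq1 hsq2 ℓ₀ hℓ₀ hdK h2K Dt hopt
      hc β ι d₁ hy M₀ hdiv hndiv hM₀ Wd hWd hrd hSel hDEF v h2v hNv hmult hK4,
    fun hSha ↦ kFourNeg_conclusion_of_pow_dvd_natCard_sha_rat hQ2 W hcm hr0 hρ hT hneg h4 K hIQ hodd h3 hHe hsq1 hsq2 ℓ₀ hℓ₀ hdK h2K Dt
      hopt hc β ι d₁ hy M₀ hdiv hndiv hM₀ Wd hWd hrd hSel hDEF v h2v hNv hmult (by rw [hSha])⟩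

/-- **K4Neg at `E` ⟺ `2^(2·M₀) ∣ #Ш(E/ℚ)[2^∞]`** (same frame): Kolyvagin's B₂ half `#Ш(E/ℚ)[2^∞] ∣ 4^(M₀)` (PAIRCOUNT) is a theorem on the frame,
so only the reverse divisibility carries content.  BSD is NOT proved by this; K4Neg is NOT proved by this.
[cite: McCallumLMS1991, §5 Thm. 5.4, Cor. 5.6] [cite: Kolyvagin1989Izv, Thm. B₂] -/
theorem kFourNeg_conclusion_iff_pow_dvd_natCard_sha_rat (hQ2 : KolyvaginRelationAtTwo)
    (W : WeierstrassCurve ℚ) [W.IsElliptic] [W.IsGloballyMinimal] [NeZero (W.conductorNorm ℤ)] (hcm : ¬ W.HasCM)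
    (hr0 : W.analyticRank = 0) (hρ : ∀ n : ℕ, 0 < n → W.HasSurjectiveModNGaloisRep ((2 : ℤ) ^ n)) (hT : Odd W.tamagawaProduct)
    (hneg : W.Δ < 0) (h4 : Nat.card (W.selmerGroup 2) = 4)
    (K : Type) [Field K] [NumberField K] (hIQ : IsImaginaryQuadratic K) (hodd : Odd (NumberField.discr K))
    (h3 : NumberField.discr K ≠ -3) (hHe : SatisfiesHeegnerHypothesis (W.conductorNorm ℤ) K)
    (hsq1 : ¬ IsSquare ((NumberField.discr K : ℚ) * -|W.Δ|)) (hsq2 : ¬ IsSquare ((NumberField.discr K : ℚ) * (-(2 * |W.Δ|))))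
    (ℓ₀ : ℕ) (hℓ₀ : ℓ₀.Prime) (hdK : NumberField.discr K = -(ℓ₀ : ℤ))
    (h2K : ((Ideal.span {(2 : ℤ)}).primesOver (𝓞 K)).ncard = 2)
    (Dt : ModularParametrizationData W (W.conductorNorm ℤ))
    (hopt : ∀ z ∈ Dt.L.lattice, ∃ w ∈ periodLattice Dt.f, z = (Dt.c : ℂ) * w) (hc : Odd Dt.c)
    (β : ℤ) (ι : K →+* ℂ) (d₁ : KolyvaginHeegnerData Dt β ι 1) (hy : ¬ IsOfFinAddOrder d₁.derivedPoint) (M₀ : ℕ)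
    (hdiv : ∃ Q : (W.baseChange (ringClassField K ι 1)).toAffine.Point, ((2 ^ M₀ : ℕ) : ℤ) • Q = d₁.derivedPoint)
    (hndiv : ¬ ∃ Q : (W.baseChange (ringClassField K ι 1)).toAffine.Point, ((2 ^ (M₀ + 1) : ℕ) : ℤ) • Q = d₁.derivedPoint)
    (hM₀ : 1 ≤ M₀) (Wd : WeierstrassCurve ℚ) [Wd.IsElliptic] [Wd.IsGloballyMinimal]
    (hWd : ∃ C : VariableChange ℚ, C • W.quadraticTwist (NumberField.discr K : ℚ) = Wd) (hrd : Wd.analyticRank = 1)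
    (hSel : Nat.card (Wd.selmerGroup 2) = 2) (hDEF : padicValNat 2 Wd.tamagawaProduct ≤ 1)
    (v : HeightOneSpectrum (𝓞 ℚ)) (h2v : ((2 : ℕ) : 𝓞 ℚ) ∉ v.asIdeal) (hNv : ((W.conductorNorm ℤ : ℕ) : 𝓞 ℚ) ∈ v.asIdeal)
    (hmult : W.HasMultiplicativeReductionAt v) :
    (∃ (n : ℕ) (d : KolyvaginHeegnerData Dt β ι n), Squarefree n ∧
      (∀ ℓ ∈ n.primeFactors, Zhang2014.IsKolyvaginPrime (W.conductorNorm ℤ) W K 2 ℓ ∧ 2 ≤ Zhang2014.kolyvaginIndex W 2 ℓ ∧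
        FrobEqFrobInfty W K 2 ℓ) ∧
      ¬ ∃ Q : (W.baseChange (ringClassField K ι n)).toAffine.Point, (2 : ℤ) • Q = d.derivedPoint) ↔
    2 ^ (2 * M₀) ∣ Nat.card (AddCommGroup.primaryComponent W.sha 2) :=
  ⟨fun hK4 ↦ by
      rw [natCard_sha_rat_two_eq_pow_of_kFourNeg_witness hQ2 W hcm hr0 hρ hT hneg h4 K hIQ hodd h3 hHe hsq1 hsq2 ℓ₀ hℓ₀ hdK h2K Dt hopt hc
        β ι d₁ hy M₀ hdiv hndiv hM₀ Wd hWd hrd hSel hDEF v h2v hNv hmult hK4],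
    fun hSha ↦ kFourNeg_conclusion_of_pow_dvd_natCard_sha_rat hQ2 W hcm hr0 hρ hT hneg h4 K hIQ hodd h3 hHe hsq1 hsq2 ℓ₀ hℓ₀ hdK h2K Dt
      hopt hc β ι d₁ hy M₀ hdiv hndiv hM₀ Wd hWd hrd hSel hDEF v h2v hNv hmult hSha⟩


/-! ## §4 The same in `Ш(E/K)`-cardinality currency -/

/-- **K4Neg's conclusion ⟹ `#Ш(E_K/K)[2^∞] = 2^(2·M₀)`** on K4Neg's frame + cut + Q2: Kolyvagin EXACTNESS at `2` (Q3R_T′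
`Theorems.equivariantKolyvaginExactAtTwoRT_proof`, with Q5R and the Q1-shape fed by their tree proofs) read on K4Neg's frame — equivalently §1 and
gk2-p4's `#Ш(E/ℚ)[2^∞] = #Ш(E/K)[2^∞]` on the cut.  BSD is NOT proved by this.
[cite: McCallumLMS1991, §5 Thm. 5.4] [cite: Kolyvagin1991MathAnn, Thm. 1] [cite: GrossLMS1991, §1 Thm. 1.3] [cite: Kramer1981, Thm. 1] -/
theorem natCard_sha_baseChange_two_eq_pow_of_kFourNeg_witness (hQ2 : KolyvaginRelationAtTwo)
    (W : WeierstrassCurve ℚ) [W.IsElliptic] [W.IsGloballyMinimal] [NeZero (W.conductorNorm ℤ)] (hcm : ¬ W.HasCM)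
    (hr0 : W.analyticRank = 0) (hρ : ∀ n : ℕ, 0 < n → W.HasSurjectiveModNGaloisRep ((2 : ℤ) ^ n)) (hT : Odd W.tamagawaProduct)
    (hneg : W.Δ < 0) (_h4 : Nat.card (W.selmerGroup 2) = 4)
    (K : Type) [Field K] [NumberField K] (hIQ : IsImaginaryQuadratic K) (hodd : Odd (NumberField.discr K))
    (h3 : NumberField.discr K ≠ -3) (hHe : SatisfiesHeegnerHypothesis (W.conductorNorm ℤ) K)
    (hsq1 : ¬ IsSquare ((NumberField.discr K : ℚ) * -|W.Δ|)) (hsq2 : ¬ IsSquare ((NumberField.discr K : ℚ) * (-(2 * |W.Δ|))))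
    (_ℓ₀ : ℕ) (_hℓ₀ : _ℓ₀.Prime) (_hdK : NumberField.discr K = -(_ℓ₀ : ℤ))
    (_h2K : ((Ideal.span {(2 : ℤ)}).primesOver (𝓞 K)).ncard = 2)
    (Dt : ModularParametrizationData W (W.conductorNorm ℤ))
    (_hopt : ∀ z ∈ Dt.L.lattice, ∃ w ∈ periodLattice Dt.f, z = (Dt.c : ℂ) * w) (_hc : Odd Dt.c)
    (β : ℤ) (ι : K →+* ℂ) (d₁ : KolyvaginHeegnerData Dt β ι 1) (hy : ¬ IsOfFinAddOrder d₁.derivedPoint) (M₀ : ℕ)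
    (hdiv : ∃ Q : (W.baseChange (ringClassField K ι 1)).toAffine.Point, ((2 ^ M₀ : ℕ) : ℤ) • Q = d₁.derivedPoint)
    (hndiv : ¬ ∃ Q : (W.baseChange (ringClassField K ι 1)).toAffine.Point, ((2 ^ (M₀ + 1) : ℕ) : ℤ) • Q = d₁.derivedPoint)
    (_hM₀ : 1 ≤ M₀) (Wd : WeierstrassCurve ℚ) [Wd.IsElliptic] [Wd.IsGloballyMinimal]
    (hWd : ∃ C : VariableChange ℚ, C • W.quadraticTwist (NumberField.discr K : ℚ) = Wd) (_hrd : Wd.analyticRank = 1)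
    (hSel : Nat.card (Wd.selmerGroup 2) = 2) (hDEF : padicValNat 2 Wd.tamagawaProduct ≤ 1)
    (v : HeightOneSpectrum (𝓞 ℚ)) (h2v : ((2 : ℕ) : 𝓞 ℚ) ∉ v.asIdeal) (hNv : ((W.conductorNorm ℤ : ℕ) : 𝓞 ℚ) ∈ v.asIdeal)
    (hmult : W.HasMultiplicativeReductionAt v)
    (hK4 : ∃ (n : ℕ) (d : KolyvaginHeegnerData Dt β ι n), Squarefree n ∧
      (∀ ℓ ∈ n.primeFactors, Zhang2014.IsKolyvaginPrime (W.conductorNorm ℤ) W K 2 ℓ ∧ 2 ≤ Zhang2014.kolyvaginIndex W 2 ℓ ∧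
        FrobEqFrobInfty W K 2 ℓ) ∧
      ¬ ∃ Q : (W.baseChange (ringClassField K ι n)).toAffine.Point, (2 : ℤ) • Q = d.derivedPoint) :
    Nat.card (AddCommGroup.primaryComponent (W.baseChange K).sha 2) = 2 ^ (2 * M₀) := by
  have hw : W.rootNumber = 1 :=
    (Literature.Barriers.BirchSwinnertonDyer.even_analyticRank_iff_of_isNewformOf_conductorLevel Dt.isNewformOf).mp
      (by rw [hr0]; exact Even.zero)
  obtain ⟨n, d, hn, hKoly, hPn⟩ := hK4
  rw [← natCard_primaryComponent_sha_rat_two_eq_baseChange_onCut hQ2 GenusExact.equivariantChebotarevAtTwoR_proof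
    GenusCyclicTorsion.cyclicTorsionOfNegDisc_proof W hcm hT v h2v hNv hmult hneg K hIQ hodd h3 hHe hsq1 hsq2 hρ Dt β ι d₁ hy M₀ hdiv hndiv
    hw Wd hWd hSel hDEF n d hn hKoly hPn]
  exact natCard_primaryComponent_sha_rat_two_eq_pow_onCut_of_kolyvaginRelation hQ2 W hcm hT v h2v hNv hmult hneg K hIQ hodd h3 hHe hsq1
    hsq2 hρ Dt β ι d₁ hy M₀ hdiv hndiv hw Wd hWd hSel hDEF n d hn hKoly hPn

/-- **`2^(2·M₀) ∣ #Ш(E_K/K)[2^∞]` ⟹ K4Neg's conclusion** on K4Neg's frame + cut + Q2: with no witness, B2Q♭ gives the `ℚ`-side exponent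
`2^(M₀−1)` on `Ш(E/ℚ)`, `rank E(ℚ) = 0` holds on the frame modulo Q2 (`mordellWeilRank_rat_eq_zero_onHabitat`), and g34's DECOUPLED sandwich
(`Lossless.natCard_primaryComponent_sha_baseChange_two_dvd_pow_of_shaExponent`, unconditional) gives `#Ш(E/K)[2^∞] ∣ 4^(M₀−1)` — absurd.
NO leaf, NO Gross–Zagier, NO GZK.  BSD is NOT proved by this; K4Neg is NOT proved by this.
[cite: McCallumLMS1991, §5 Lemma 5.3, Thm. 5.4] [cite: Kolyvagin1989Izv, Thm. B₂] [cite: Kramer1981, Thm. 1, §2 Prop. 3] [cite: GrossLMS1991, §5 Prop. 5.3] -/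
theorem kFourNeg_conclusion_of_pow_dvd_natCard_sha_baseChange (hQ2 : KolyvaginRelationAtTwo)
    (W : WeierstrassCurve ℚ) [W.IsElliptic] [W.IsGloballyMinimal] [NeZero (W.conductorNorm ℤ)] (hcm : ¬ W.HasCM)
    (hr0 : W.analyticRank = 0) (hρ : ∀ n : ℕ, 0 < n → W.HasSurjectiveModNGaloisRep ((2 : ℤ) ^ n)) (hT : Odd W.tamagawaProduct)
    (hneg : W.Δ < 0) (_h4 : Nat.card (W.selmerGroup 2) = 4)
    (K : Type) [Field K] [NumberField K] (hIQ : IsImaginaryQuadratic K) (hodd : Odd (NumberField.discr K))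
    (h3 : NumberField.discr K ≠ -3) (hHe : SatisfiesHeegnerHypothesis (W.conductorNorm ℤ) K)
    (hsq1 : ¬ IsSquare ((NumberField.discr K : ℚ) * -|W.Δ|)) (hsq2 : ¬ IsSquare ((NumberField.discr K : ℚ) * (-(2 * |W.Δ|))))
    (_ℓ₀ : ℕ) (_hℓ₀ : _ℓ₀.Prime) (_hdK : NumberField.discr K = -(_ℓ₀ : ℤ))
    (_h2K : ((Ideal.span {(2 : ℤ)}).primesOver (𝓞 K)).ncard = 2)
    (Dt : ModularParametrizationData W (W.conductorNorm ℤ))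
    (_hopt : ∀ z ∈ Dt.L.lattice, ∃ w ∈ periodLattice Dt.f, z = (Dt.c : ℂ) * w) (_hc : Odd Dt.c)
    (β : ℤ) (ι : K →+* ℂ) (d₁ : KolyvaginHeegnerData Dt β ι 1) (hy : ¬ IsOfFinAddOrder d₁.derivedPoint) (M₀ : ℕ)
    (_hdiv : ∃ Q : (W.baseChange (ringClassField K ι 1)).toAffine.Point, ((2 ^ M₀ : ℕ) : ℤ) • Q = d₁.derivedPoint)
    (hndiv : ¬ ∃ Q : (W.baseChange (ringClassField K ι 1)).toAffine.Point, ((2 ^ (M₀ + 1) : ℕ) : ℤ) • Q = d₁.derivedPoint)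
    (hM₀ : 1 ≤ M₀) (Wd : WeierstrassCurve ℚ) [Wd.IsElliptic] [Wd.IsGloballyMinimal]
    (hWd : ∃ C : VariableChange ℚ, C • W.quadraticTwist (NumberField.discr K : ℚ) = Wd) (_hrd : Wd.analyticRank = 1)
    (hSel : Nat.card (Wd.selmerGroup 2) = 2) (hDEF : padicValNat 2 Wd.tamagawaProduct ≤ 1)
    (v : HeightOneSpectrum (𝓞 ℚ)) (h2v : ((2 : ℕ) : 𝓞 ℚ) ∉ v.asIdeal) (hNv : ((W.conductorNorm ℤ : ℕ) : 𝓞 ℚ) ∈ v.asIdeal)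
    (hmult : W.HasMultiplicativeReductionAt v)
    (hShaK : 2 ^ (2 * M₀) ∣ Nat.card (AddCommGroup.primaryComponent (W.baseChange K).sha 2)) :
    ∃ (n : ℕ) (d : KolyvaginHeegnerData Dt β ι n), Squarefree n ∧
      (∀ ℓ ∈ n.primeFactors, Zhang2014.IsKolyvaginPrime (W.conductorNorm ℤ) W K 2 ℓ ∧ 2 ≤ Zhang2014.kolyvaginIndex W 2 ℓ ∧
        FrobEqFrobInfty W K 2 ℓ) ∧
      ¬ ∃ Q : (W.baseChange (ringClassField K ι n)).toAffine.Point, (2 : ℤ) • Q = d.derivedPoint := by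
  haveI : Fact (Nat.Prime 2) := ⟨Nat.prime_two⟩
  have hρ2 : W.HasSurjectiveModNGaloisRep 2 := by simpa using hρ 1 one_pos
  have hw : W.rootNumber = 1 :=
    (Literature.Barriers.BirchSwinnertonDyer.even_analyticRank_iff_of_isNewformOf_conductorLevel Dt.isNewformOf).mp
      (by rw [hr0]; exact Even.zero)
  -- `rank E(ℚ) = 0` on the frame, modulo Q2 (Kolyvagin over `ℚ` at `2`)
  have hrk0 : W.mordellWeilRank = 0 :=
    mordellWeilRank_rat_eq_zero_onHabitat hQ2 W hcm hT v h2v hNv hmult hneg K hIQ hodd h3 hHe hsq1 hsq2 hρ Dt β ι d₁ M₀ hndiv hw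
  by_contra hno
  have hB2Q : ∀ (k : ℕ) (a : W.galH1), a ∈ W.sha → ((2 ^ k : ℕ) : ℤ) • a = 0 → ((2 ^ (M₀ - 1) : ℕ) : ℤ) • a = 0 := by
    intro k a ha hka
    by_contra hne
    rcases Nat.eq_zero_or_pos k with rfl | hkpos
    · rw [pow_zero, Nat.cast_one, one_zsmul] at hka
      exact hne (by rw [hka, zsmul_zero])
    · have hn : ((2 ^ k : ℕ) : ℤ) ≠ 0 := by positivity
      have hmem : a ∈ W.sha ⊓ torsionBy W.galH1 ((2 ^ k : ℕ) : ℤ) :=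
        AddSubgroup.mem_inf.mpr ⟨ha, by change ((2 ^ k : ℕ) : ℤ) • a = 0; exact hka⟩
      rw [← WeierstrassCurve.map_torsionH1ToH1_selmerGroup_holds W hn] at hmem
      obtain ⟨x, hx, rfl⟩ := AddSubgroup.mem_map.mp hmem
      have hne' : ((2 ^ (M₀ - 1) : ℕ) : ℤ) • x ≠ 0 := fun h ↦ hne (by rw [← map_zsmul, h, map_zero])
      exact hno (kFourNeg_shape_of_two_pow_pred_smul_ne_zero hQ2 W hcm hneg hT v h2v hNv hmult K hIQ hodd h3 hHe hsq1 hsq2 hρ Dt β ι d₁ M₀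
        hndiv hw ⟨k, x, hx, hne'⟩)
  have hdvd := Lossless.natCard_primaryComponent_sha_baseChange_two_dvd_pow_of_shaExponent W K hT hIQ hodd hHe hρ2 Dt β ι d₁ hy M₀ hndiv hw
    hrk0 Wd hWd hSel (Or.inl ⟨hneg, hDEF⟩) hB2Q
  have hle : 2 * M₀ ≤ 2 * (M₀ - 1) := (Nat.pow_dvd_pow_iff_le_right (by norm_num : 1 < 2)).mp (hShaK.trans hdvd)
  omega

/-- **K4Neg at `E` ⟺ `#Ш(E_K/K)[2^∞] = 2^(2·M₀)` ⟺ `2^(2·M₀) ∣ #Ш(E_K/K)[2^∞]`** (K4Neg's frame + cut + Q2): Kolyvagin's upper bound U_T′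
`#Ш(E/K)[2^∞] ∣ 4^(M₀)` is a theorem on the frame, so K₄ is exactly the SHARPNESS of Kolyvagin's bound over `K` (McCallum: `𝓜_∞ = 0`).
BSD is NOT proved by this; K4Neg is NOT proved by this. [cite: McCallumLMS1991, §5 Thm. 5.4, Thm. 5.8] [cite: Kolyvagin1991MathAnn, Thm. 1] -/
theorem kFourNeg_conclusion_iff_natCard_sha_baseChange (hQ2 : KolyvaginRelationAtTwo)
    (W : WeierstrassCurve ℚ) [W.IsElliptic] [W.IsGloballyMinimal] [NeZero (W.conductorNorm ℤ)] (hcm : ¬ W.HasCM)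
    (hr0 : W.analyticRank = 0) (hρ : ∀ n : ℕ, 0 < n → W.HasSurjectiveModNGaloisRep ((2 : ℤ) ^ n)) (hT : Odd W.tamagawaProduct)
    (hneg : W.Δ < 0) (h4 : Nat.card (W.selmerGroup 2) = 4)
    (K : Type) [Field K] [NumberField K] (hIQ : IsImaginaryQuadratic K) (hodd : Odd (NumberField.discr K))
    (h3 : NumberField.discr K ≠ -3) (hHe : SatisfiesHeegnerHypothesis (W.conductorNorm ℤ) K)
    (hsq1 : ¬ IsSquare ((NumberField.discr K : ℚ) * -|W.Δ|)) (hsq2 : ¬ IsSquare ((NumberField.discr K : ℚ) * (-(2 * |W.Δ|))))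
    (ℓ₀ : ℕ) (hℓ₀ : ℓ₀.Prime) (hdK : NumberField.discr K = -(ℓ₀ : ℤ))
    (h2K : ((Ideal.span {(2 : ℤ)}).primesOver (𝓞 K)).ncard = 2)
    (Dt : ModularParametrizationData W (W.conductorNorm ℤ))
    (hopt : ∀ z ∈ Dt.L.lattice, ∃ w ∈ periodLattice Dt.f, z = (Dt.c : ℂ) * w) (hc : Odd Dt.c)
    (β : ℤ) (ι : K →+* ℂ) (d₁ : KolyvaginHeegnerData Dt β ι 1) (hy : ¬ IsOfFinAddOrder d₁.derivedPoint) (M₀ : ℕ)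
    (hdiv : ∃ Q : (W.baseChange (ringClassField K ι 1)).toAffine.Point, ((2 ^ M₀ : ℕ) : ℤ) • Q = d₁.derivedPoint)
    (hndiv : ¬ ∃ Q : (W.baseChange (ringClassField K ι 1)).toAffine.Point, ((2 ^ (M₀ + 1) : ℕ) : ℤ) • Q = d₁.derivedPoint)
    (hM₀ : 1 ≤ M₀) (Wd : WeierstrassCurve ℚ) [Wd.IsElliptic] [Wd.IsGloballyMinimal]
    (hWd : ∃ C : VariableChange ℚ, C • W.quadraticTwist (NumberField.discr K : ℚ) = Wd) (hrd : Wd.analyticRank = 1)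
    (hSel : Nat.card (Wd.selmerGroup 2) = 2) (hDEF : padicValNat 2 Wd.tamagawaProduct ≤ 1)
    (v : HeightOneSpectrum (𝓞 ℚ)) (h2v : ((2 : ℕ) : 𝓞 ℚ) ∉ v.asIdeal) (hNv : ((W.conductorNorm ℤ : ℕ) : 𝓞 ℚ) ∈ v.asIdeal)
    (hmult : W.HasMultiplicativeReductionAt v) :
    ((∃ (n : ℕ) (d : KolyvaginHeegnerData Dt β ι n), Squarefree n ∧
      (∀ ℓ ∈ n.primeFactors, Zhang2014.IsKolyvaginPrime (W.conductorNorm ℤ) W K 2 ℓ ∧ 2 ≤ Zhang2014.kolyvaginIndex W 2 ℓ ∧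
        FrobEqFrobInfty W K 2 ℓ) ∧
      ¬ ∃ Q : (W.baseChange (ringClassField K ι n)).toAffine.Point, (2 : ℤ) • Q = d.derivedPoint) ↔
      Nat.card (AddCommGroup.primaryComponent (W.baseChange K).sha 2) = 2 ^ (2 * M₀)) ∧
    ((∃ (n : ℕ) (d : KolyvaginHeegnerData Dt β ι n), Squarefree n ∧
      (∀ ℓ ∈ n.primeFactors, Zhang2014.IsKolyvaginPrime (W.conductorNorm ℤ) W K 2 ℓ ∧ 2 ≤ Zhang2014.kolyvaginIndex W 2 ℓ ∧
        FrobEqFrobInfty W K 2 ℓ) ∧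
      ¬ ∃ Q : (W.baseChange (ringClassField K ι n)).toAffine.Point, (2 : ℤ) • Q = d.derivedPoint) ↔
      2 ^ (2 * M₀) ∣ Nat.card (AddCommGroup.primaryComponent (W.baseChange K).sha 2)) := by
  refine ⟨⟨fun hK4 ↦ ?_, fun hShaK ↦ ?_⟩, ⟨fun hK4 ↦ ?_, fun hShaK ↦ ?_⟩⟩
  · exact natCard_sha_baseChange_two_eq_pow_of_kFourNeg_witness hQ2 W hcm hr0 hρ hT hneg h4 K hIQ hodd h3 hHe hsq1 hsq2 ℓ₀ hℓ₀ hdK h2K Dt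
      hopt hc β ι d₁ hy M₀ hdiv hndiv hM₀ Wd hWd hrd hSel hDEF v h2v hNv hmult hK4
  · exact kFourNeg_conclusion_of_pow_dvd_natCard_sha_baseChange hQ2 W hcm hr0 hρ hT hneg h4 K hIQ hodd h3 hHe hsq1 hsq2 ℓ₀ hℓ₀ hdK h2K Dt
      hopt hc β ι d₁ hy M₀ hdiv hndiv hM₀ Wd hWd hrd hSel hDEF v h2v hNv hmult (by rw [hShaK])
  · rw [natCard_sha_baseChange_two_eq_pow_of_kFourNeg_witness hQ2 W hcm hr0 hρ hT hneg h4 K hIQ hodd h3 hHe hsq1 hsq2 ℓ₀ hℓ₀ hdK h2K Dt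
      hopt hc β ι d₁ hy M₀ hdiv hndiv hM₀ Wd hWd hrd hSel hDEF v h2v hNv hmult hK4]
  · exact kFourNeg_conclusion_of_pow_dvd_natCard_sha_baseChange hQ2 W hcm hr0 hρ hT hneg h4 K hIQ hodd h3 hHe hsq1 hsq2 ℓ₀ hℓ₀ hdK h2K Dt
      hopt hc β ι d₁ hy M₀ hdiv hndiv hM₀ Wd hWd hrd hSel hDEF v h2v hNv hmult hShaK

end Summit.BirchSwinnertonDyer.BirchSwinnertonDyer.Theorems.GenusSupplyNarrow.KFourCell.ShaCardCurrency

end
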